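import Summits.ResolutionOfSingularities.ResolutionOfSingularities.Theorems.FrobeniusLadderFRationalResolutionPrimaryCentreAtIsolatedPoint
import Summits.ResolutionOfSingularities.ResolutionOfSingularities.Theorems.FrobeniusLadderFRationalResolutionFanSupportSparing
import Summits.ResolutionOfSingularities.ResolutionOfSingularities.Theorems.FrobeniusLadderFRationalResolutionRegularFaceOfOrthantLike
import HarnessLib

/-!
# Crux `FrobeniusLadder.FRationalResolution` (stmt-ResolutionOfSingularities-15317), line `redirect`,
# stub `stub_diagonalizableQuotientResolution` — ASSEMBLY (ε₁′): the `𝔮`-primary monomial centre at an isolated singular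
# «fixed» point of a log regular chart, WITHOUT fan data (the fan brick (α′) and the dictionary (ι″) supplied)

`…PrimaryCentreAtIsolatedPoint.exists_primary_monomialCentre_of_isolated` (ε₁) took the regular subdivision and its support
function as data. Here they are PRODUCED: `Fan.exists_regular_refinement_isStrictSupport_sparing` (…FanSupportSparing:
regularisation by star subdivisions sparing the regular faces, support function vanishing there and positive at the first
star point) and `…RegularFaceOfOrthantLike.exists_regular_face_of_isOrthantLike` (orthant-like localisation ⇒ the orthogonal
face is a regular face on dual basis vectors). What remains as hypotheses on the fan side: the face fan of `P^∨` is
primitively simplicial (true at `D(A)`-fixed points, where `P^∨` is the image of an orthant) and not regular (the point is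
singular).

* **`exists_primary_monomialCentre_of_isolated'`** — `A` Noetherian, fs spanning chart `φ : P → A` log regular at all primes,
  `𝔮` maximal `⊇ φ(P ∖ 0)` with Kato ideal localizing to `𝔮`, all other primes regular, face fan of `P^∨` primitively
  simplicial and not regular ⇒ a monomial centre `J = (φ(s))`, `s ⊆ P ∖ 0`, with `Bl_J Spec A` REGULAR, `J ⊆ 𝔮`, and
  `(𝔮B)ᴺ ⊆ JB` on every localization away from some `g ∉ 𝔮` (the input of `…EtaleChartPrimaryCentre`).

Honest label: assembly (no stub closed by name). No definitions, no named facts, no sorry.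
[cite: Kato1994, Def. (2.1), (6.1), (9.8), (10.3), (10.4)] [cite: KempfEtAl1973, Ch. I §2 Thm. 11] [cite: Fulton1993Toric, §2.6]
-/

noncomputable section

-- single-problem summit: the doubled namespace component is forced
set_option linter.dupNamespace false

open AlgebraicGeometry
open Literature.AlgebraicGeometry.Resolution Literature.Geometry.PolyhedralFans PointedCone
open Literature.Combinatorics.Optimization.HilbertBasis (toRat toRat_add toRat_zero toRat_nsmul)
open Literature.AlgebraicGeometry.Resolution.LogBlowup Literature.AlgebraicGeometry.Resolution.LogChart
open Summit.ResolutionOfSingularities.ResolutionOfSingularities.Theorems.FRationalResolution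

namespace Summit.ResolutionOfSingularities.ResolutionOfSingularities.Theorems.FRationalResolution.PrimaryCentreAtIsolatedPointFan

variable {n : ℕ} {A : Type} [CommRing A] {P : AddSubmonoid (Fin n → ℤ)} {φ : Multiplicative P →* A}

/-- **(ε₁′) The `𝔮`-primary monomial centre with regular blow-up at an isolated singular «fixed» point of a log regular
chart — fan data produced.** See the module docstring. [cite: Kato1994, Def. (2.1), (6.1), (10.3), (10.4)]
[cite: KempfEtAl1973, Ch. I §2 Thm. 11] -/
theorem exists_primary_monomialCentre_of_isolated' [IsNoetherianRing A] (hP : P.FG)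
    (hsat : ∀ (v : Fin n → ℤ) (k : ℕ), 0 < k → k • v ∈ P → v ∈ P)
    (hspan : Submodule.span ℤ (P : Set (Fin n → ℤ)) = ⊤)
    (hreg : ∀ (𝔭 : Ideal A) [𝔭.IsPrime], IsLogRegularAt P φ 𝔭)
    (𝔮 : Ideal A) [h𝔮 : 𝔮.IsMaximal] (hfix : ∀ p : P, (p : Fin n → ℤ) ≠ 0 → φ (Multiplicative.ofAdd p) ∈ 𝔮)
    (hI𝔮 : ∀ r ∈ 𝔮, ∃ u ∉ 𝔮, u * r ∈ ideal P φ 𝔮)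
    (hisol : ∀ (𝔓 : Ideal A) [𝔓.IsPrime], 𝔓 ≠ 𝔮 → IsRegularLocalRing (Localization.AtPrime 𝔓))
    (hps : (Fan.ofCone (dualCone P) (dualCone_fg P hP) (isSalient_dualCone P hspan)).IsPrimSimplicial)
    (hnreg : ¬ (Fan.ofCone (dualCone P) (dualCone_fg P hP) (isSalient_dualCone P hspan)).IsRegular) :
    ∃ s : Finset P, s.Nonempty ∧
      Scheme.IsRegular (affineBlowup
        (Ideal.span ((fun p : P => φ (Multiplicative.ofAdd p)) '' (s : Set P)))) ∧
      Ideal.span ((fun p : P => φ (Multiplicative.ofAdd p)) '' (s : Set P)) ≤ 𝔮 ∧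
      ∃ g ∉ 𝔮, ∀ (B : Type) [CommRing B] [Algebra A B] [IsLocalization.Away g B],
        ∃ N : ℕ, (𝔮.map (algebraMap A B)) ^ N ≤
          (Ideal.span ((fun p : P => φ (Multiplicative.ofAdd p)) '' (s : Set P))).map (algebraMap A B) := by
  classical
  set σ := dualCone P with hσdef
  set Δ₀ := Fan.ofCone σ (dualCone_fg P hP) (isSalient_dualCone P hspan) with hΔ₀
  -- the fan data
  obtain ⟨l, hl, href, hregΔ, m, hm, hint, hnn, hspare, hposl⟩ :=
    Fan.exists_regular_refinement_isStrictSupport_sparing σ (dualCone_fg P hP) (isSalient_dualCone P hspan) hps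
  set Δ' := Δ₀.starIter l with hΔ'
  have hsupp : Δ'.support = (σ : Set (Fin n → ℚ)) := by rw [hΔ', href.support_eq, Fan.support_ofCone]
  have hlne : l ≠ [] := by
    rintro rfl
    exact hnreg (by simpa [hΔ'] using hregΔ)
  obtain ⟨ρ₀, hρ₀, v₀, hv₀, hpos₀⟩ := hposl hlne
  -- vanishing on the orthogonal faces of orthant-like unit faces
  have hfaces : ∀ (𝔓 : Ideal A) [𝔓.IsPrime],
      (∃ (b : Module.Basis (Fin n) ℤ (Fin n → ℤ)) (I : Finset (Fin n)), LogRefinedChart.IsOrthantLike b I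
        (P ⊔ (Submodule.span ℤ ((fun p : P => (p : Fin n → ℤ)) '' face P φ 𝔓)).toAddSubmonoid)) →
      ∀ ρ ∈ Δ'.cones, ∀ v ∈ ρ, (∀ q : P, q ∈ face P φ 𝔓 → toRat (q : Fin n → ℤ) ⬝ᵥ v = 0) → m ρ ⬝ᵥ v = 0 := by
    intro 𝔓 _ hOL ρ hρ v hv hperp
    obtain ⟨b, I, hQ⟩ := hOL
    have hFP : (fun p : P => (p : Fin n → ℤ)) '' face P φ 𝔓 ⊆ (P : Set (Fin n → ℤ)) := by
      rintro _ ⟨q, -, rfl⟩; exact q.2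
    obtain ⟨τ, T, hT, hTreg, hface, hperpτ⟩ :=
      RegularFaceOfOrthantLike.exists_regular_face_of_isOrthantLike P _ hFP hQ
    have hτ₀ : τ ∈ Δ₀.cones := (Fan.mem_ofCone_iff).2 hface
    obtain ⟨-, hvan⟩ := hspare τ hτ₀ T hT hTreg
    have hvσ : v ∈ σ := by
      have : v ∈ Δ'.support := Fan.mem_support.2 ⟨ρ, hρ, hv⟩
      rwa [hsupp] at this
    refine hvan ρ hρ v hv (hperpτ v hvσ fun q hq => ?_)
    obtain ⟨q', hq', rfl⟩ := hq
    exact hperp q' hq'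
  exact PrimaryCentreAtIsolatedPoint.exists_primary_monomialCentre_of_isolated hP hsat hspan hreg 𝔮 hfix hI𝔮 hisol
    Δ' hsupp hregΔ m hm hint hnn ⟨ρ₀, hρ₀, v₀, hv₀, hpos₀⟩ hfaces

end Summit.ResolutionOfSingularities.ResolutionOfSingularities.Theorems.FRationalResolution.PrimaryCentreAtIsolatedPointFan

end
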